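import Summits.AnomalousDissipation.AnomalousDissipation.Theorems.SawtoothPulseCascadeK1LocalisedCascadeStripBlock
import Literature.Analysis.FunctionSpaces.TorusShearKoopman

/-!
# K1loc, line `Spectral` / thin start — helper: AXIS-MARGINAL SPECTRA ARE INVARIANT UNDER SAME-AXIS SHEARS

Helper file of the prover lane on the crux `K1LocalisedCascade` (stmt-AnomalousDissipation-19491), route
`SawtoothPulseCascade` (S-B/S-C assembly seat; Fourier bookkeeping for the S-D channel functionals).  Every inviscid half-pulse
of the cascade is a transversal shear `Φ(x) = x − φ(x_j)eᵢ` (`Torus.shearMap i j φ`, H: `i = 0, j = 1`, V: `i = 1, j = 0`).  Along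
the sheared axis `eᵢ` the shear is, on every line, a TRANSLATION, so the twisted axis average
`A^i_m v(x) = ∫ e_{−m}(s) v(x + s eᵢ) ds` (`…StripBlock`: its spectrum is the slab `{kᵢ = m}` of the spectrum of `v`) picks up only
a unimodular factor: **`A^i_m (v ∘ Φ)(x) = e_{−m}(φ(x_j))·A^i_m v(x)`** (`twistedAxisAvg_comp_shearMap`), hence
`‖A^i_m(v ∘ Φ)‖ = ‖A^i_m v‖` pointwise and, by Parseval on the slab (`…StripBlock.hasSum_slab`),
**`Σ_{k : kᵢ = m} ‖𝓕(v ∘ Φ)(k)‖² = Σ_{k : kᵢ = m} ‖𝓕v(k)‖²` for every `m`** (`hasSum_slab_comp_shearMap`): the `i`-marginal of the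
spectrum is invariant.  Summing the slabs with a bounded weight `w(kᵢ)` (fibrewise summation, `hasSum_fibreWeight`) gives
**`Σ' k, w(kᵢ)‖𝓕(v ∘ Φ)(k)‖² = Σ' k, w(kᵢ)‖𝓕v(k)‖²`** (`tsum_fibreWeight_comp_shearMap`, real-scalar form
`tsum_fibreWeight_comp_shearMap_real`): for the cascade, every HORIZONTAL functional `Σ w(k₀)|𝓕·|²` (low band, strip, the
saturated horizontal progress functional `Φ_n` of the crux idea `renormalised-escape-weight` — its first lemma `HStepInvariance`)
is EXACTLY invariant under the H half-step, and every vertical one under the V half-step (`tsum_horizontalWeight_hstep`,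
`tsum_verticalWeight_vstep`).  No definitions; no statement about the crux.
[cite: Grafakos2014, Prop. 3.1.2 (5) (coefficients of translates) and Prop. 3.2.7 (3) (Parseval)] [problem: turb]
-/

-- `Summit.<Summit>.<Problem>`: single-conjunct summit, the duplicate namespace segment is deliberate.
set_option linter.dupNamespace false

noncomputable section

namespace Summit.AnomalousDissipation.AnomalousDissipation.Theorems.SawtoothPulseCascade.K1Start

open MeasureTheory Set Filter Topology UnitAddTorus Function
open Literature.Analysis.FunctionSpaces Literature.Analysis.FunctionSpaces.Torus

variable {d : Type*} [Fintype d] [DecidableEq d]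

/-! ## §1 The twisted axis average under a shear along the same axis -/

omit [Fintype d] in
/-- Characters turn translations into unimodular factors: `e_n(s + c) = e_n(c)·e_n(s)`. [cite: Grafakos2014, Prop. 3.1.2 (5)] -/
theorem fourier_apply_add (n : ℤ) (s c : UnitAddCircle) : (fourier n (s + c) : ℂ) = fourier n c * fourier n s := by
  rw [fourier_apply, zsmul_add, AddCircle.toCircle_add, Circle.coe_mul, fourier_apply, fourier_apply, mul_comm]

omit [Fintype d] in
/-- **A shear along the averaged axis twists the axis average by a unimodular factor**: for `i ≠ j`, a profile `φ` and any
`v`, `∫ e_{−m}(s) (v ∘ Φ)(x + s eᵢ) ds = e_{−m}(φ(x_j)) · ∫ e_{−m}(s) v(x + s eᵢ) ds`, `Φ(y) = y − φ(y_j)eᵢ` (on the line through `x`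
in direction `eᵢ` the shear is the translation by `−φ(x_j)`; Haar invariance of `ds`). [cite: Grafakos2014, Prop. 3.1.2 (5)] -/
theorem twistedAxisAvg_comp_shearMap (v : UnitAddTorus d → ℂ) {i j : d} (hij : i ≠ j) (P : ShearProfile) (m : ℤ)
    (x : UnitAddTorus d) :
    ∫ s : UnitAddCircle, (fourier (-m) s : ℂ) • (v ∘ shearMap i j P) (x + Pi.single i s) =
      twist P m (x j) * ∫ s : UnitAddCircle, (fourier (-m) s : ℂ) • v (x + Pi.single i s) := by
  set c : UnitAddCircle := ((P.onCircle (x j) : ℝ) : UnitAddCircle) with hc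
  -- on the line through `x` in direction `eᵢ` the shear is the translation by `−c`
  have hline : ∀ s : UnitAddCircle, (v ∘ shearMap i j P) (x + Pi.single i s) = v (x + Pi.single i (s - c)) := by
    intro s
    have hj : (x + Pi.single i s : UnitAddTorus d) j = x j := by
      rw [Pi.add_apply, Pi.single_eq_of_ne (Ne.symm hij), add_zero]
    rw [comp_apply, shearMap_apply, hj, ← hc, Pi.single_sub, add_sub_assoc]
  simp_rw [hline]
  -- substitute `s ↦ s + c`
  set F : UnitAddCircle → ℂ := fun t => (fourier (-m) (t + c) : ℂ) • v (x + Pi.single i t) with hF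
  have hsub : ∫ s : UnitAddCircle, (fourier (-m) s : ℂ) • v (x + Pi.single i (s - c)) =
      ∫ s : UnitAddCircle, (fourier (-m) (s + c) : ℂ) • v (x + Pi.single i s) := by
    have h := integral_sub_right_eq_self (μ := (volume : Measure UnitAddCircle)) F c
    simp only [hF, sub_add_cancel] at h
    exact h
  rw [hsub]
  simp_rw [fourier_apply_add (-m) _ c, mul_smul, integral_smul, smul_eq_mul, twist_apply, hc]

omit [Fintype d] in
/-- **The modulus of the twisted axis average is shear-invariant** (same axis): `‖A^i_m(v ∘ Φ)(x)‖ = ‖A^i_m v(x)‖`.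
[cite: Grafakos2014, Prop. 3.1.2 (5)] -/
theorem norm_twistedAxisAvg_comp_shearMap (v : UnitAddTorus d → ℂ) {i j : d} (hij : i ≠ j) (P : ShearProfile) (m : ℤ)
    (x : UnitAddTorus d) :
    ‖∫ s : UnitAddCircle, (fourier (-m) s : ℂ) • (v ∘ shearMap i j P) (x + Pi.single i s)‖ =
      ‖∫ s : UnitAddCircle, (fourier (-m) s : ℂ) • v (x + Pi.single i s)‖ := by
  rw [twistedAxisAvg_comp_shearMap v hij P m x, norm_mul, norm_twist, one_mul]

/-! ## §2 Slab sums are shear-invariant -/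

/-- **Parseval on a slab, sheared**: for continuous `v` and `i ≠ j`,
`Σ_k [kᵢ = m]‖𝓕(v ∘ Φ)(k)‖² = ∫ ‖A^i_m v‖²` — the same value as for `v` (`…StripBlock.hasSum_slab`).
[cite: Grafakos2014, Prop. 3.2.7 (3)] -/
theorem hasSum_slab_comp_shearMap {v : UnitAddTorus d → ℂ} (hv : Continuous v) {i j : d} (hij : i ≠ j) (P : ShearProfile)
    (m : ℤ) :
    HasSum (fun k : d → ℤ => (if k i = m then (1 : ℝ) else 0) * ‖mFourierCoeff (v ∘ shearMap i j P) k‖ ^ 2)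
      (∫ x : UnitAddTorus d, ‖∫ s : UnitAddCircle, (fourier (-m) s : ℂ) • v (x + Pi.single i s)‖ ^ 2) := by
  have h := hasSum_slab (hv.comp (continuous_shearMap i j P)) i m
  have e : (∫ x : UnitAddTorus d, ‖∫ s : UnitAddCircle, (fourier (-m) s : ℂ) • (v ∘ shearMap i j P) (x + Pi.single i s)‖ ^ 2) =
      ∫ x : UnitAddTorus d, ‖∫ s : UnitAddCircle, (fourier (-m) s : ℂ) • v (x + Pi.single i s)‖ ^ 2 :=
    integral_congr_ae (Eventually.of_forall fun x => by simp only [norm_twistedAxisAvg_comp_shearMap v hij P m x])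
  rwa [e] at h

/-- **Slab sums are shear-invariant**: `Σ' k, [kᵢ = m]‖𝓕(v ∘ Φ)(k)‖² = Σ' k, [kᵢ = m]‖𝓕v(k)‖²` (`v` continuous, `i ≠ j`).
[cite: Grafakos2014, Prop. 3.2.7 (3)] -/
theorem tsum_slab_comp_shearMap {v : UnitAddTorus d → ℂ} (hv : Continuous v) {i j : d} (hij : i ≠ j) (P : ShearProfile)
    (m : ℤ) :
    ∑' k : d → ℤ, (if k i = m then (1 : ℝ) else 0) * ‖mFourierCoeff (v ∘ shearMap i j P) k‖ ^ 2 =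
      ∑' k : d → ℤ, (if k i = m then (1 : ℝ) else 0) * ‖mFourierCoeff v k‖ ^ 2 := by
  rw [(hasSum_slab_comp_shearMap hv hij P m).tsum_eq, (hasSum_slab hv i m).tsum_eq]

/-! ## §3 Fibrewise summation: weights depending on one coordinate of the frequency -/

omit [Fintype d] [DecidableEq d] in
/-- **Fibrewise summation of a weighted spectral series.**  Let `c ≥ 0` be summable on `ℤ^d` with slab sums
`HasSum (k ↦ [kᵢ = m]·c(k)) (S m)` for every `m`, and let `w : ℤ → ℝ` be bounded, `|w| ≤ C`.  Then
`HasSum (m ↦ w(m)·S(m)) (Σ' k, w(kᵢ)·c(k))`. [cite: Grafakos2014, Prop. 3.2.7 (3)] -/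
theorem hasSum_fibreWeight (i : d) {c : (d → ℤ) → ℝ} (hc : Summable c) (hc0 : ∀ k, 0 ≤ c k) {S : ℤ → ℝ}
    (hS : ∀ m, HasSum (fun k : d → ℤ => (if k i = m then (1 : ℝ) else 0) * c k) (S m)) {w : ℤ → ℝ} {C : ℝ}
    (hw : ∀ m, |w m| ≤ C) :
    HasSum (fun m : ℤ => w m * S m) (∑' k : d → ℤ, w (k i) * c k) := by
  classical
  -- the weighted series is absolutely summable
  have hsw : Summable fun k : d → ℤ => w (k i) * c k := by
    refine Summable.of_norm_bounded (g := fun k => C * c k) (hc.mul_left C) fun k => ?_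
    rw [Real.norm_eq_abs, abs_mul, abs_of_nonneg (hc0 k)]
    exact mul_le_mul_of_nonneg_right (hw _) (hc0 k)
  -- regroup along the fibres `{k : kᵢ = m}`
  set e := Equiv.sigmaFiberEquiv (fun k : d → ℤ => k i) with he
  have h1 : HasSum ((fun k : d → ℤ => w (k i) * c k) ∘ e) (∑' k : d → ℤ, w (k i) * c k) :=
    (e.hasSum_iff.2 hsw.hasSum)
  refine h1.sigma fun m => ?_
  -- on the fibre over `m` the weight is the constant `w m`
  have h2 : HasSum (fun k : {k : d → ℤ // k i = m} => c (k : d → ℤ)) (S m) := by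
    have h3 := hS m
    have h4 : (fun k : d → ℤ => (if k i = m then (1 : ℝ) else 0) * c k) = Set.indicator {k | k i = m} c := by
      funext k
      simp only [Set.indicator, Set.mem_setOf_eq]
      split_ifs <;> simp
    rw [h4, ← hasSum_subtype_iff_indicator] at h3
    exact h3
  refine (h2.mul_left (w m)).congr_fun fun k => ?_
  obtain ⟨k, hk⟩ := k
  simp only [Function.comp_apply, he, Equiv.sigmaFiberEquiv_apply]
  rw [show k i = m from hk]

/-- **Weighted marginal = weighted sum of slab energies**: for continuous `v` and bounded `w`,
`Σ' k, w(kᵢ)‖𝓕v(k)‖² = Σ' m, w(m)·∫ ‖A^i_m v‖²`. [cite: Grafakos2014, Prop. 3.2.7 (3)] -/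
theorem tsum_fibreWeight_eq {v : UnitAddTorus d → ℂ} (hv : Continuous v) (i : d) {w : ℤ → ℝ} {C : ℝ} (hw : ∀ m, |w m| ≤ C) :
    ∑' k : d → ℤ, w (k i) * ‖mFourierCoeff v k‖ ^ 2 =
      ∑' m : ℤ, w m * ∫ x : UnitAddTorus d, ‖∫ s : UnitAddCircle, (fourier (-m) s : ℂ) • v (x + Pi.single i s)‖ ^ 2 :=
  ((hasSum_fibreWeight i (hasSum_sq_mFourierCoeff_of_continuous hv).summable (fun _ => sq_nonneg _)
    (fun m => hasSum_slab hv i m) hw).tsum_eq).symm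

/-- **Weighted marginals are shear-invariant** (same axis): for continuous `v`, `i ≠ j`, a profile `φ` and a bounded weight `w`,
`Σ' k, w(kᵢ)‖𝓕(v ∘ Φ)(k)‖² = Σ' k, w(kᵢ)‖𝓕v(k)‖²`, `Φ(y) = y − φ(y_j)eᵢ`. [cite: Grafakos2014, Prop. 3.2.7 (3)] -/
theorem tsum_fibreWeight_comp_shearMap {v : UnitAddTorus d → ℂ} (hv : Continuous v) {i j : d} (hij : i ≠ j)
    (P : ShearProfile) {w : ℤ → ℝ} {C : ℝ} (hw : ∀ m, |w m| ≤ C) :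
    ∑' k : d → ℤ, w (k i) * ‖mFourierCoeff (v ∘ shearMap i j P) k‖ ^ 2 =
      ∑' k : d → ℤ, w (k i) * ‖mFourierCoeff v k‖ ^ 2 := by
  have hvΦ : Continuous (v ∘ shearMap i j P) := hv.comp (continuous_shearMap i j P)
  rw [← (hasSum_fibreWeight i (hasSum_sq_mFourierCoeff_of_continuous hvΦ).summable (fun _ => sq_nonneg _)
    (fun m => hasSum_slab_comp_shearMap hv hij P m) hw).tsum_eq, tsum_fibreWeight_eq hv i hw]

/-- **Real scalars**: `Σ' k, w(kᵢ)‖𝓕(θ ∘ Φ)(k)‖² = Σ' k, w(kᵢ)‖𝓕θ(k)‖²` for continuous real `θ`, `i ≠ j`, bounded `w`.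
[cite: Grafakos2014, Prop. 3.2.7 (3)] -/
theorem tsum_fibreWeight_comp_shearMap_real {θ : UnitAddTorus d → ℝ} (hθ : Continuous θ) {i j : d} (hij : i ≠ j)
    (P : ShearProfile) {w : ℤ → ℝ} {C : ℝ} (hw : ∀ m, |w m| ≤ C) :
    ∑' k : d → ℤ, w (k i) * ‖mFourierCoeff (fun x => ((θ ∘ shearMap i j P) x : ℂ)) k‖ ^ 2 =
      ∑' k : d → ℤ, w (k i) * ‖mFourierCoeff (fun x => (θ x : ℂ)) k‖ ^ 2 := by
  have h := tsum_fibreWeight_comp_shearMap (Complex.continuous_ofReal.comp hθ) hij P hw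
  exact h

/-! ## §4 The cascade: horizontal functionals through the H half-step, vertical ones through the V half-step -/

/-- **H half-step: every horizontal spectral functional is invariant.**  For `b = a ∘ shearMap 0 1 ψ` (the inviscid H half-step,
any profile `ψ`) and any bounded weight `w` of the horizontal frequency, `Σ' k, w(k₀)‖𝓕b(k)‖² = Σ' k, w(k₀)‖𝓕a(k)‖²` — in
particular the low band, the strip and the saturated horizontal progress functional do not move during H half-steps.
[cite: Grafakos2014, Prop. 3.2.7 (3)] -/
theorem tsum_horizontalWeight_hstep {a b : UnitAddTorus (Fin 2) → ℝ} (ha : Continuous a) (ψ : ShearProfile)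
    (hb : b = a ∘ shearMap 0 1 ψ) {w : ℤ → ℝ} {C : ℝ} (hw : ∀ m, |w m| ≤ C) :
    ∑' k : Fin 2 → ℤ, w (k 0) * ‖mFourierCoeff (fun x => (b x : ℂ)) k‖ ^ 2 =
      ∑' k : Fin 2 → ℤ, w (k 0) * ‖mFourierCoeff (fun x => (a x : ℂ)) k‖ ^ 2 := by
  rw [hb]
  exact tsum_fibreWeight_comp_shearMap_real ha (by decide) ψ hw

/-- **V half-step: every vertical spectral functional is invariant.**  For `a' = b ∘ shearMap 1 0 ψ` (the inviscid V half-step)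
and any bounded weight `w` of the vertical frequency, `Σ' k, w(k₁)‖𝓕a'(k)‖² = Σ' k, w(k₁)‖𝓕b(k)‖²`.
[cite: Grafakos2014, Prop. 3.2.7 (3)] -/
theorem tsum_verticalWeight_vstep {b a' : UnitAddTorus (Fin 2) → ℝ} (hb : Continuous b) (ψ : ShearProfile)
    (ha' : a' = b ∘ shearMap 1 0 ψ) {w : ℤ → ℝ} {C : ℝ} (hw : ∀ m, |w m| ≤ C) :
    ∑' k : Fin 2 → ℤ, w (k 1) * ‖mFourierCoeff (fun x => (a' x : ℂ)) k‖ ^ 2 =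
      ∑' k : Fin 2 → ℤ, w (k 1) * ‖mFourierCoeff (fun x => (b x : ℂ)) k‖ ^ 2 := by
  rw [ha']
  exact tsum_fibreWeight_comp_shearMap_real hb (by decide) ψ hw

end Summit.AnomalousDissipation.AnomalousDissipation.Theorems.SawtoothPulseCascade.K1Start
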